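import Summits.QuantumFields.BalabanUV.Beta.EriceFlowEnclosureB12AsPrintedHistoryContagion

/-!
# Beta / EriceFlowEnclosureB12AsPrintedHistoryContagionProfile — ASYMPTOTIC FREEDOM IS CONTAGIOUS, part 2 (the contagion proper): under
# coupling-chart history moduli with FADING MEMORY, ONE run of (0.20) carrying (0.31)'s lower half from its end forces EVERY run of the same
# depth ending at a small coupling g to stay below 2g and to carry (0.31)'s lower half at a quarter of the rate (and its upper half, with no
# (U) letter) — whence same-depth runs pinned at the same small g COINCIDE, with NO asymptotic-freedom letter, NO sign letter, NO g-uniform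
# reading of Theorem 2 and NO box-versus-rate smallness (β-flow team, prover 1 = recursion ∕ upper ∕ bare-coupling ∕ UNIQUENESS side, unit
# `b2b-balaban-beta-bflow-p1`, gen 35; ROW AP-I·U, fourth reading; part 1 `…HistoryContagion` = the comparison kernel; part 3
# `…HistoryContagionEnd` = carrier ∕ Theorem-2-AS-TYPED ENDs, the θ = 1 failure and the no-reference failure)

HONEST FRAMING (page 1 of everything the β sub-cell writes): discharging `BetaPertH` makes Bałaban's UV stability UNCONDITIONAL — a
real constructive-QFT result; it is NOT the continuum limit and NOT the Clay problem.  HONEST DEPENDENCY (cell reorg 2026-08-19,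
verbatim): «continuum YM on T⁴ ⇐ BetaPertH ∧ nine spine estimates (0/9 proved); BetaPertH ⇐ (D1) ∧ (D4) ∧ CAP+tail; G-an2-4 gates
asym, D1 and NE2/3/4.»  THIS MODULE DISCHARGES NOTHING: [folklore] finite-sum calculus over runs of the printed recursion (0.20)
(`FlowStep.RGEqH`, history-dependent β on an abstract `Setting S` of the statement-exact typing `B12BetaAsPrinted` of [I] = T. Bałaban,
Commun. Math. Phys. **109** (1987) [Balaban1987RG1]) under node U2's HYPOTHESIS SHAPES `T4CouplingMatching.HistLipschitz ∕ FadingMemory` (NOT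
printed: [I] p. 298 says only that β_j *"depends also on all preceding coupling constants"*) and ONE reference run obeying (0.31)'s lower half
from its own end (the shape `Step.Discrete031` which [I] Theorem 2 p. 259 — STATED WITHOUT PROOF — asserts for its tuned run).  Every letter is
a hypothesis; nothing of Bałaban's β is asserted.

THE POINT.  Part 1 bounds the difference of the displacements of A and T over [j, K) by Cγ∕(1 − θ)² + (C∕(1 − θ))(E(K − j) + Σ_l F_l), E an
envelope of A's RECENT couplings, F_l the reference profile.  Take E = 2g, g = A_K: if A's couplings above scale j are already known to lie
below 2g (backward induction), then with `4Cg ≤ β*(1 − θ)` the recent term costs half the rate, the reference profile's sum t_K + (2∕β*)√a_{K−j}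
is absorbed into a quarter of the rate plus constants by c·√a ≤ c² + a∕4, and the old history is a constant — so (§3 `disp_abs_le_absorbed`)
|ΔA − ΔT| ≤ Q + (3β*∕4)(K − j), Q = Cγ∕(1 − θ)² + Ct_K∕(1 − θ) + (2C∕((1 − θ)β*))² + 1∕(4t_K²); with ΔT ≥ β*(K − j) and `g²Q ≤ 3∕4` this gives
1∕A_j² ≥ 1∕g² − 3∕(4g²) + (β*∕4)(K − j), i.e. **`1∕(4g²) + (β*∕4)(K − j) ≤ 1∕A_j²`** — which reproduces the envelope A_j ≤ 2g one scale down and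
closes the induction (§3 `inv_sq_lower_of_reference`): EVERY run ending at g below the explicit threshold (§3 `threshold_exists`) stays below 2g
and is asymptotically free at rate β*∕4 from the base point 2g, whatever its bare end, with no sign or rate assumed for β anywhere and no
condition tying the box γ to the modulus (Cγ³ may be large — the Markov fold regime of row U: runs ending near zero never reach coupling ≈ γ).
The same comparison read upward (§3 `inv_sq_upper_of_reference`) gives (0.31)'s UPPER half along A from T's, with no (U) letter: two-sided
logarithmic running with ONE pair of constants and an END-ANCHORED defect 3∕(4g²) — the g-dependence the typed Theorem 2 allows its constants
is confined to that defect.  Two runs pinned at the same small g then have weight sum ≤ 8g³ + 16g∕β* (§4, node U2's `sum_profWeights_le` at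
base 2g, rate β*∕4) and gen 33's `runs_eq_of_fadingMemory` closes: §4 **`runs_eq_of_reference_fadingMemory`**.

WHAT THIS FILE PROVES (0 sorry, 0 def):
§3 `le_two_mul_of_profile`, **`disp_abs_le_absorbed`**, **`inv_sq_lower_of_reference`** (THE CONTAGION), `inv_sq_upper_of_reference`,
   `le_two_mul_end_of_reference` (A_j ≤ 2A_K), `threshold_exists`.
§4 `sum_weights_le_of_reference`, **`runs_eq_of_reference_fadingMemory`**.
NOT CLAIMED: any modulus, sign or bound for Bałaban's β; Theorem 2; `BetaPertH`; continuum; Clay.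
-/

namespace Summit.QuantumFields.BalabanUV.Beta.EriceFlowEnclosureB12AsPrintedHistoryContagionProfile

open Finset
open Literature.MathematicalPhysics.QuantumFieldTheory.Balaban1983to89
open Literature.MathematicalPhysics.QuantumFieldTheory.Balaban1983to89.B12BetaAsPrinted
open Literature.MathematicalPhysics.QuantumFieldTheory.Balaban1983to89.FlowStep (prefixOf Box mem_box box_mono RGEqH)
open Literature.MathematicalPhysics.QuantumFieldTheory.Balaban1983to89.T4CouplingMatching (HistLipschitz FadingMemory prof sprof
  sprof_pos sprof_sq prof_pos sprof_zero sum_profWeights_le)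
open Summit.QuantumFields.BalabanUV.Beta.EriceFlowEnclosureB12AsPrintedHistoryUnique (runs_eq_of_fadingMemory)
open Summit.QuantumFields.BalabanUV.Beta.EriceFlowEnclosureB12AsPrintedHistoryContagion (mul_sprof_le ref_le_invSprof sum_invSprof_Ico_le
  disp_abs_le_of_reference)

noncomputable section

variable {S : Setting}

/-! ## §3 The contagion: every run ending at a small coupling is asymptotically free from its end -/

/-- From the quarter-rate profile at base 2e to the envelope: `1∕(4e²) + (β*∕4)n ≤ 1∕x²` (n ≥ 0) gives `x ≤ 2e`. [folklore] -/
theorem le_two_mul_of_profile {bs e x n : ℝ} (hbs : 0 ≤ bs) (he : 0 < e) (hx : 0 < x) (hn : 0 ≤ n)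
    (h : 1 / (4 * e ^ 2) + bs / 4 * n ≤ 1 / x ^ 2) : x ≤ 2 * e := by
  have h2 : 1 / (4 * e ^ 2) ≤ 1 / x ^ 2 := by linarith [mul_nonneg (by positivity : (0 : ℝ) ≤ bs / 4) hn]
  have h3 : x ^ 2 ≤ (2 * e) ^ 2 := by
    rw [show (2 * e) ^ 2 = 4 * e ^ 2 by ring]
    exact (one_div_le_one_div (by positivity : (0 : ℝ) < 4 * e ^ 2) (pow_pos hx 2)).mp h2
  exact (pow_le_pow_iff_left₀ hx.le (by positivity) two_ne_zero).mp h3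

/-- **THE ABSORBED DISPLACEMENT COMPARISON.**  Under the moduli, with the reference run T carrying (0.31)'s lower half from its end at rate β* > 0,
if the recent couplings of A lie below twice its endpoint (A_i ≤ 2A_K for j < i ≤ K) and `4C·A_K ≤ β*(1 − θ)`, then
`|(1∕A_j² − 1∕A_K²) − (1∕T_j² − 1∕T_K²)| ≤ Q + (3β*∕4)(K − j)` with the CONSTANT `Q = Cγ∕(1 − θ)² + Ct_K∕(1 − θ) + (2C∕((1 − θ)β*))² + 1∕(4t_K²)`
(`disp_abs_le_of_reference` with E = 2A_K and F_l = 1∕√a_{K−l}, the profile sum `sum_invSprof_Ico_le`, and the absorption `mul_sprof_le` of the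
square root into a quarter of the rate). [cite: Balaban1987RG1, Thm 2 (0.31) p.259 with (0.20) p.256 and p.298] -/
theorem disp_abs_le_absorbed {γ θ C bs : ℝ} {Λ : ℕ → ℕ → ℝ} {K j : ℕ} {g t : ℕ → ℝ}
    (hθ0 : 0 ≤ θ) (hθ1 : θ < 1) (hC : 0 ≤ C) (hbs : 0 < bs)
    (hL : HistLipschitz Λ γ S.β) (hΛ : FadingMemory C θ Λ)
    (hg : RGEqH K S.β g) (ht : RGEqH K S.β t)
    (hbox : ∀ i, i ≤ K → 0 < g i ∧ g i ≤ γ) (hboxt : ∀ i, i ≤ K → 0 < t i ∧ t i ≤ γ) (hjK : j ≤ K)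
    (h031 : ∀ i, i ≤ K → 1 / (t K) ^ 2 + bs * ((K : ℝ) - i) ≤ 1 / (t i) ^ 2)
    (hs1 : 4 * C * g K ≤ bs * (1 - θ)) (hE : ∀ i, j < i → i ≤ K → g i ≤ 2 * g K) :
    |(1 / (g j) ^ 2 - 1 / (g K) ^ 2) - (1 / (t j) ^ 2 - 1 / (t K) ^ 2)|
      ≤ (C * γ / (1 - θ) ^ 2 + C / (1 - θ) * t K + (2 * C / ((1 - θ) * bs)) ^ 2 + 1 / (4 * (t K) ^ 2))
        + 3 * bs / 4 * ((K : ℝ) - j) := by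
  have h1θ : 0 < 1 - θ := by linarith
  have he := (hbox K le_rfl).1
  have htK := (hboxt K le_rfl).1
  have hKj : (0 : ℝ) ≤ (K : ℝ) - j := sub_nonneg.mpr (by exact_mod_cast hjK)
  have hF : ∀ l i, j ≤ l → l < K → i ≤ l → t i ≤ 1 / sprof (t K) bs (K - l) :=
    fun l i _ hlK hil => ref_le_invSprof hbs (fun i hi => (hboxt i hi).1) h031 hil hlK.le
  have hF0 : ∀ l, 0 ≤ 1 / sprof (t K) bs (K - l) := fun l => (one_div_pos.mpr (sprof_pos htK hbs.le _)).le
  have hdisp := disp_abs_le_of_reference (E := 2 * g K) (F := fun l => 1 / sprof (t K) bs (K - l))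
    hθ0 hθ1 hC hL hΛ hg ht hbox hboxt hjK (by positivity) hE hF0 hF
  have hexp : C / (1 - θ) * (2 * g K * ((K : ℝ) - j) + ∑ l ∈ Ico j K, 1 / sprof (t K) bs (K - l))
      = C / (1 - θ) * (2 * g K * ((K : ℝ) - j)) + C / (1 - θ) * ∑ l ∈ Ico j K, 1 / sprof (t K) bs (K - l) :=
    mul_add _ _ _
  -- the recent part of T, summed and absorbed
  have hS : C / (1 - θ) * ∑ l ∈ Ico j K, 1 / sprof (t K) bs (K - l)
      ≤ C / (1 - θ) * t K + 2 * C / ((1 - θ) * bs) * sprof (t K) bs (K - j) := by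
    calc C / (1 - θ) * ∑ l ∈ Ico j K, 1 / sprof (t K) bs (K - l)
        ≤ C / (1 - θ) * (t K + 2 / bs * sprof (t K) bs (K - j)) :=
          mul_le_mul_of_nonneg_left (sum_invSprof_Ico_le htK hbs hjK) (by positivity)
      _ = C / (1 - θ) * t K + 2 * C / ((1 - θ) * bs) * sprof (t K) bs (K - j) := by
          field_simp
  have hab := mul_sprof_le htK hbs.le (2 * C / ((1 - θ) * bs)) (K - j)
  have hprof : prof (t K) bs (K - j) = 1 / (t K) ^ 2 + bs * ((K : ℝ) - j) := by
    unfold T4CouplingMatching.prof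
    rw [Nat.cast_sub hjK]
  rw [hprof] at hab
  have h4 : 1 / (4 * (t K) ^ 2) = (1 / (t K) ^ 2) / 4 := by
    field_simp
  -- the linear part of the recent history of A
  have hlin : C / (1 - θ) * (2 * g K) ≤ bs / 2 := by
    rw [div_mul_eq_mul_div, div_le_iff₀ h1θ]
    linarith
  have hlin' : C / (1 - θ) * (2 * g K * ((K : ℝ) - j)) ≤ bs / 2 * ((K : ℝ) - j) := by
    calc C / (1 - θ) * (2 * g K * ((K : ℝ) - j)) = C / (1 - θ) * (2 * g K) * ((K : ℝ) - j) := by ring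
      _ ≤ bs / 2 * ((K : ℝ) - j) := mul_le_mul_of_nonneg_right hlin hKj
  linarith [hdisp, hexp, hS, hab, hlin', h4]

/-- **ASYMPTOTIC FREEDOM IS CONTAGIOUS (THE LOWER PROFILE OF EVERY SMALL-ENDPOINT RUN).**  Data: coupling-chart moduli `HistLipschitz Λ γ S.β`,
`FadingMemory C θ Λ` (0 ≤ θ < 1, C ≥ 0); a REFERENCE run T of (0.20) of depth K in ]0, γ] carrying (0.31)'s lower half from its end at rate
β* > 0 (`1∕t_K² + β*(K − i) ≤ 1∕t_i²`, endpoint t_K arbitrary); ANY run A of (0.20) of depth K in ]0, γ] whose endpoint g = A_K satisfies the two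
explicit smallness conditions `4Cg ≤ β*(1 − θ)` and `g²·Q ≤ 3∕4`, Q the constant of `disp_abs_le_absorbed`.  CONCLUSION: for every j ≤ K,
**`1∕(4g²) + (β*∕4)(K − j) ≤ 1∕A_j²`** — A stays below 2g at every scale and carries (0.31)'s lower half at rate β*∕4 from the base point 2g.
NO sign or lower bound on β, NO condition relating the box γ to the modulus or the rate, NOTHING assumed about A's bare end.  Proof: backward
induction on j — the induction hypothesis supplies the envelope A_i ≤ 2g on the recent history, `disp_abs_le_absorbed` the step.
[cite: Balaban1987RG1, Thm 2 (0.31) p.259 with (0.20) p.256 and p.298] -/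
theorem inv_sq_lower_of_reference {γ θ C bs : ℝ} {Λ : ℕ → ℕ → ℝ} {K : ℕ} {g t : ℕ → ℝ}
    (hθ0 : 0 ≤ θ) (hθ1 : θ < 1) (hC : 0 ≤ C) (hbs : 0 < bs)
    (hL : HistLipschitz Λ γ S.β) (hΛ : FadingMemory C θ Λ)
    (hg : RGEqH K S.β g) (ht : RGEqH K S.β t)
    (hbox : ∀ i, i ≤ K → 0 < g i ∧ g i ≤ γ) (hboxt : ∀ i, i ≤ K → 0 < t i ∧ t i ≤ γ)
    (h031 : ∀ i, i ≤ K → 1 / (t K) ^ 2 + bs * ((K : ℝ) - i) ≤ 1 / (t i) ^ 2)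
    (hs1 : 4 * C * g K ≤ bs * (1 - θ))
    (hs2 : (g K) ^ 2 * (C * γ / (1 - θ) ^ 2 + C / (1 - θ) * t K + (2 * C / ((1 - θ) * bs)) ^ 2 + 1 / (4 * (t K) ^ 2))
      ≤ 3 / 4) :
    ∀ j, j ≤ K → 1 / (4 * (g K) ^ 2) + bs / 4 * ((K : ℝ) - j) ≤ 1 / (g j) ^ 2 := by
  have he := (hbox K le_rfl).1
  -- the constant budget
  have hQ : C * γ / (1 - θ) ^ 2 + C / (1 - θ) * t K + (2 * C / ((1 - θ) * bs)) ^ 2 + 1 / (4 * (t K) ^ 2)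
      ≤ 3 / (4 * (g K) ^ 2) := by
    rw [le_div_iff₀ (by positivity)]
    linarith
  have h5 : 1 / (4 * (g K) ^ 2) + 3 / (4 * (g K) ^ 2) = 1 / (g K) ^ 2 := by
    field_simp
    norm_num
  -- backward induction on the depth below the end
  suffices H : ∀ d j, j + d = K → ∀ i, j ≤ i → i ≤ K →
      1 / (4 * (g K) ^ 2) + bs / 4 * ((K : ℝ) - i) ≤ 1 / (g i) ^ 2 from
    fun j hj => H (K - j) j (Nat.add_sub_cancel' hj) j le_rfl hj
  intro d
  induction d with
  | zero =>
    intro j hj i hji hiK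
    have hi : i = K := by omega
    subst hi
    have h6 : 1 / (4 * (g i) ^ 2) ≤ 1 / (g i) ^ 2 :=
      one_div_le_one_div_of_le (by positivity) (by nlinarith [sq_nonneg (g i)])
    simpa using h6
  | succ d ih =>
    intro j hj i hji hiK
    rcases eq_or_lt_of_le hji with heq | hlt
    · subst heq
      have hjK : j ≤ K := by omega
      have IH := ih (j + 1) (by omega)
      -- the recent history of A lies below 2 g_K
      have hE : ∀ i, j < i → i ≤ K → g i ≤ 2 * g K := fun i hji' hiK' =>
        le_two_mul_of_profile hbs.le he (hbox i hiK').1 (sub_nonneg.mpr (by exact_mod_cast hiK')) (IH i (by omega) hiK')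
      have hD := (abs_sub_le_iff.mp
        (disp_abs_le_absorbed hθ0 hθ1 hC hbs hL hΛ hg ht hbox hboxt hjK h031 hs1 hE)).2
      -- T's own displacement
      have hT : bs * ((K : ℝ) - j) ≤ 1 / (t j) ^ 2 - 1 / (t K) ^ 2 := by
        have := h031 j hjK
        linarith
      linarith [hD, hT, hQ, h5]
    · exact ih (j + 1) (by omega) i (by omega) hiK

/-- **… AND (0.31)'s UPPER HALF IS CONTAGIOUS TOO — WITH NO UPPER LETTER (U).**  If the reference run also carries (0.31)'s upper half from its end
(`1∕t_i² ≤ 1∕t_K² + β′*(K − i)`), then under the data of `inv_sq_lower_of_reference` every j ≤ K has **`1∕A_j² ≤ 7∕(4g²) + (β′* + 3β*∕4)(K − j)`**.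
So along EVERY run ending at a small coupling g the printed two-sided logarithmic running holds with ONE pair of constants (β*∕4, β′* + 3β*∕4)
and an END-ANCHORED defect 3∕(4g²) on either side: the g-dependence which the typed Theorem 2 (`Missing.B12Thm2Shape`: β, β′ chosen after g)
allows its constants is confined to that defect. [cite: Balaban1987RG1, Thm 2 (0.31) p.259 with (0.20) p.256 and p.298] -/
theorem inv_sq_upper_of_reference {γ θ C bs bs' : ℝ} {Λ : ℕ → ℕ → ℝ} {K : ℕ} {g t : ℕ → ℝ}
    (hθ0 : 0 ≤ θ) (hθ1 : θ < 1) (hC : 0 ≤ C) (hbs : 0 < bs)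
    (hL : HistLipschitz Λ γ S.β) (hΛ : FadingMemory C θ Λ)
    (hg : RGEqH K S.β g) (ht : RGEqH K S.β t)
    (hbox : ∀ i, i ≤ K → 0 < g i ∧ g i ≤ γ) (hboxt : ∀ i, i ≤ K → 0 < t i ∧ t i ≤ γ)
    (h031 : ∀ i, i ≤ K → 1 / (t K) ^ 2 + bs * ((K : ℝ) - i) ≤ 1 / (t i) ^ 2)
    (h031' : ∀ i, i ≤ K → 1 / (t i) ^ 2 ≤ 1 / (t K) ^ 2 + bs' * ((K : ℝ) - i))
    (hs1 : 4 * C * g K ≤ bs * (1 - θ))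
    (hs2 : (g K) ^ 2 * (C * γ / (1 - θ) ^ 2 + C / (1 - θ) * t K + (2 * C / ((1 - θ) * bs)) ^ 2 + 1 / (4 * (t K) ^ 2))
      ≤ 3 / 4) :
    ∀ j, j ≤ K → 1 / (g j) ^ 2 ≤ 7 / (4 * (g K) ^ 2) + (bs' + 3 * bs / 4) * ((K : ℝ) - j) := by
  intro j hjK
  have he := (hbox K le_rfl).1
  have hA := inv_sq_lower_of_reference hθ0 hθ1 hC hbs hL hΛ hg ht hbox hboxt h031 hs1 hs2
  have hE : ∀ i, j < i → i ≤ K → g i ≤ 2 * g K := fun i _ hiK' =>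
    le_two_mul_of_profile hbs.le he (hbox i hiK').1 (sub_nonneg.mpr (by exact_mod_cast hiK')) (hA i hiK')
  have hD := (abs_sub_le_iff.mp (disp_abs_le_absorbed hθ0 hθ1 hC hbs hL hΛ hg ht hbox hboxt hjK h031 hs1 hE)).1
  have hQ : C * γ / (1 - θ) ^ 2 + C / (1 - θ) * t K + (2 * C / ((1 - θ) * bs)) ^ 2 + 1 / (4 * (t K) ^ 2)
      ≤ 3 / (4 * (g K) ^ 2) := by
    rw [le_div_iff₀ (by positivity)]
    linarith
  have h7 : 1 / (g K) ^ 2 + 3 / (4 * (g K) ^ 2) = 7 / (4 * (g K) ^ 2) := by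
    field_simp
    norm_num
  have hT := h031' j hjK
  linarith [hD, hT, hQ, h7]

/-- **EVERY SMALL-ENDPOINT RUN STAYS BELOW TWICE ITS ENDPOINT** (the envelope form of the contagion): under the data of
`inv_sq_lower_of_reference`, `A_j ≤ 2A_K` at every j ≤ K — whatever the bare end, with no sign assumed for β. [cite: Balaban1987RG1, Thm 2 (0.31) p.259 with (0.20) p.256 and p.298] -/
theorem le_two_mul_end_of_reference {γ θ C bs : ℝ} {Λ : ℕ → ℕ → ℝ} {K : ℕ} {g t : ℕ → ℝ}
    (hθ0 : 0 ≤ θ) (hθ1 : θ < 1) (hC : 0 ≤ C) (hbs : 0 < bs)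
    (hL : HistLipschitz Λ γ S.β) (hΛ : FadingMemory C θ Λ)
    (hg : RGEqH K S.β g) (ht : RGEqH K S.β t)
    (hbox : ∀ i, i ≤ K → 0 < g i ∧ g i ≤ γ) (hboxt : ∀ i, i ≤ K → 0 < t i ∧ t i ≤ γ)
    (h031 : ∀ i, i ≤ K → 1 / (t K) ^ 2 + bs * ((K : ℝ) - i) ≤ 1 / (t i) ^ 2)
    (hs1 : 4 * C * g K ≤ bs * (1 - θ))
    (hs2 : (g K) ^ 2 * (C * γ / (1 - θ) ^ 2 + C / (1 - θ) * t K + (2 * C / ((1 - θ) * bs)) ^ 2 + 1 / (4 * (t K) ^ 2))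
      ≤ 3 / 4) :
    ∀ j, j ≤ K → g j ≤ 2 * g K := fun j hj =>
  le_two_mul_of_profile hbs.le (hbox K le_rfl).1 (hbox j hj).1 (sub_nonneg.mpr (by exact_mod_cast hj))
    (inv_sq_lower_of_reference hθ0 hθ1 hC hbs hL hΛ hg ht hbox hboxt h031 hs1 hs2 j hj)

/-- **THE THRESHOLD EXISTS**: for β* > 0, C ≥ 0, θ < 1, a reference endpoint g* > 0 and any γ, some e₀ > 0 makes every endpoint e ∈ ]0, e₀] satisfy
the two smallness conditions of `inv_sq_lower_of_reference` and the weight-sum smallness `C(8e³ + 16e∕β*) ≤ (1 − θ)∕2` of §4. [folklore] -/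
theorem threshold_exists {γ θ C bs : ℝ} (gs : ℝ) (hθ1 : θ < 1) (hC : 0 ≤ C) (hbs : 0 < bs) :
    ∃ e₀ : ℝ, 0 < e₀ ∧ ∀ e : ℝ, 0 < e → e ≤ e₀ →
      4 * C * e ≤ bs * (1 - θ) ∧
      e ^ 2 * (C * γ / (1 - θ) ^ 2 + C / (1 - θ) * gs + (2 * C / ((1 - θ) * bs)) ^ 2 + 1 / (4 * gs ^ 2)) ≤ 3 / 4 ∧
      C * (8 * e ^ 3 + 16 * e / bs) ≤ (1 - θ) / 2 := by
  have h1θ : 0 < 1 - θ := by linarith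
  set Q : ℝ := C * γ / (1 - θ) ^ 2 + C / (1 - θ) * gs + (2 * C / ((1 - θ) * bs)) ^ 2 + 1 / (4 * gs ^ 2) with hQ
  have hQ'0 : 0 < |Q| + 1 := by positivity
  have hA0 : 0 < (C + 1) * (8 + 16 / bs) := by positivity
  refine ⟨min 1 (min (bs * (1 - θ) / (4 * C + 1)) (min (3 / (4 * (|Q| + 1))) ((1 - θ) / (2 * ((C + 1) * (8 + 16 / bs)))))),
    lt_min one_pos (lt_min (by positivity) (lt_min (by positivity) (by positivity))), fun e he hle => ?_⟩
  have h1 : e ≤ 1 := hle.trans (min_le_left _ _)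
  have h2 : e ≤ bs * (1 - θ) / (4 * C + 1) := hle.trans ((min_le_right _ _).trans (min_le_left _ _))
  have h3 : e ≤ 3 / (4 * (|Q| + 1)) :=
    hle.trans ((min_le_right _ _).trans ((min_le_right _ _).trans (min_le_left _ _)))
  have h4 : e ≤ (1 - θ) / (2 * ((C + 1) * (8 + 16 / bs))) :=
    hle.trans ((min_le_right _ _).trans ((min_le_right _ _).trans (min_le_right _ _)))
  refine ⟨?_, ?_, ?_⟩
  · rw [le_div_iff₀ (by positivity)] at h2
    nlinarith
  · rw [le_div_iff₀ (by positivity)] at h3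
    have he2 : e ^ 2 ≤ e := by nlinarith
    have hQle : Q ≤ |Q| := le_abs_self Q
    nlinarith [mul_le_mul_of_nonneg_left hQle (sq_nonneg e), abs_nonneg Q, mul_nonneg he.le (abs_nonneg Q)]
  · rw [le_div_iff₀ (by positivity)] at h4
    have he21 : e ^ 2 ≤ 1 := by nlinarith
    have he3 : e ^ 3 ≤ e := by
      calc e ^ 3 = e * e ^ 2 := by ring
        _ ≤ e * 1 := mul_le_mul_of_nonneg_left he21 he.le
        _ = e := mul_one e
    have h16 : 0 ≤ 16 / bs := by positivity
    have hsum : 8 * e ^ 3 + 16 * e / bs ≤ e * (8 + 16 / bs) := by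
      rw [mul_add, show 16 * e / bs = e * (16 / bs) by ring]
      linarith
    calc C * (8 * e ^ 3 + 16 * e / bs) ≤ (C + 1) * (e * (8 + 16 / bs)) := by
          have h0 : 0 ≤ 8 * e ^ 3 + 16 * e / bs := by positivity
          nlinarith
      _ = e * ((C + 1) * (8 + 16 / bs)) := by ring
      _ ≤ (1 - θ) / 2 := by linarith

/-! ## §4 Two runs pinned at the same small coupling coincide -/

/-- **THE AF WEIGHT SUM FROM THE CONTAGION PROFILES**: two runs with couplings > 0, pinned g_K = g′_K = e, BOTH carrying the quarter-rate profile
`1∕(4e²) + (β*∕4)(K − i) ≤ 1∕g_i²` of §3: `Σ_{i≤K} g_i² g′_i ≤ 8e³ + 16e∕β*` — node U2's telescoped profile sum `sum_profWeights_le` at base point 2e and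
rate β*∕4 (gen 33 read the profile off the AF letter, prover 2's part 6 off (0.31) at the same endpoint; here it comes from ONE reference run
ending anywhere). [cite: Balaban1987RG1, Thm 2 (0.31) p.259] -/
theorem sum_weights_le_of_reference {bs : ℝ} {K : ℕ} {g g' : ℕ → ℝ} (hbs : 0 < bs)
    (hpos : ∀ i, i ≤ K → 0 < g i) (hpos' : ∀ i, i ≤ K → 0 < g' i) (hpin : g K = g' K)
    (hA : ∀ j, j ≤ K → 1 / (4 * (g K) ^ 2) + bs / 4 * ((K : ℝ) - j) ≤ 1 / (g j) ^ 2)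
    (hB : ∀ j, j ≤ K → 1 / (4 * (g' K) ^ 2) + bs / 4 * ((K : ℝ) - j) ≤ 1 / (g' j) ^ 2) :
    ∑ i ∈ range (K + 1), (g i) ^ 2 * g' i ≤ 8 * (g K) ^ 3 + 16 * g K / bs := by
  have he := hpos K le_rfl
  have hbs0 : bs ≠ 0 := hbs.ne'
  have h2e : 0 < 2 * g K := by positivity
  have hb4 : 0 < bs / 4 := by positivity
  have hp0 := sprof_pos h2e hb4.le
  have hprof : ∀ i, i ≤ K → prof (2 * g K) (bs / 4) (K - i) = 1 / (4 * (g K) ^ 2) + bs / 4 * ((K : ℝ) - i) := by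
    intro i hi
    unfold T4CouplingMatching.prof
    rw [Nat.cast_sub hi]
    ring
  have hpt : ∀ i, i ≤ K →
      (g i) ^ 2 * g' i ≤ 1 / (sprof (2 * g K) (bs / 4) (K - i)) ^ 2 * (1 / sprof (2 * g K) (bs / 4) (K - i)) := by
    intro i hi
    have hgi := hpos i hi
    have hgi' := hpos' i hi
    have ha : prof (2 * g K) (bs / 4) (K - i) ≤ 1 / (g i) ^ 2 := by rw [hprof i hi]; exact hA i hi
    have ha' : prof (2 * g K) (bs / 4) (K - i) ≤ 1 / (g' i) ^ 2 := by rw [hprof i hi, hpin]; exact hB i hi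
    have hsq : (g i) ^ 2 ≤ 1 / (sprof (2 * g K) (bs / 4) (K - i)) ^ 2 := by
      rw [sprof_sq h2e hb4.le, le_one_div (pow_pos hgi 2) (prof_pos h2e hb4.le _)]; exact ha
    have hsq' : (g' i) ^ 2 ≤ (1 / sprof (2 * g K) (bs / 4) (K - i)) ^ 2 := by
      rw [one_div_pow, sprof_sq h2e hb4.le, le_one_div (pow_pos hgi' 2) (prof_pos h2e hb4.le _)]; exact ha'
    have h' : g' i ≤ 1 / sprof (2 * g K) (bs / 4) (K - i) :=
      (pow_le_pow_iff_left₀ hgi'.le (one_div_pos.mpr (hp0 _)).le two_ne_zero).mp hsq'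
    exact mul_le_mul hsq h' hgi'.le (by positivity)
  calc ∑ i ∈ range (K + 1), (g i) ^ 2 * g' i
      ≤ ∑ i ∈ range (K + 1), 1 / (sprof (2 * g K) (bs / 4) (K - i)) ^ 2 * (1 / sprof (2 * g K) (bs / 4) (K - i)) :=
        Finset.sum_le_sum fun i hi => hpt i (Nat.lt_succ_iff.mp (mem_range.mp hi))
    _ ≤ (2 * g K) ^ 3 + 2 * (2 * g K) / (bs / 4) := sum_profWeights_le h2e hb4 K
    _ = 8 * (g K) ^ 3 + 16 * g K / bs := by
        field_simp
        ring

/-- **TWO RUNS PINNED AT THE SAME SMALL COUPLING COINCIDE — FROM ONE REFERENCE RUN, SIGN-FREE AND RATE-FREE.**  Two runs g, g′ of (0.20) of the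
same depth K with the same history-dependent β, couplings in ]0, γ], pinned g_K = g′_K = e; coupling-chart moduli `HistLipschitz Λ γ S.β` with
`FadingMemory C θ Λ` (0 < θ < 1, C ≥ 0); ONE reference run t of (0.20) of depth K in ]0, γ] carrying (0.31)'s lower half from its end at rate β* > 0
(ending anywhere); and the endpoint e below the threshold: `4Ce ≤ β*(1 − θ)`, `e²·(Cγ∕(1 − θ)² + Ct_K∕(1 − θ) + (2C∕((1 − θ)β*))² + 1∕(4t_K²)) ≤ 3∕4`,
`C(8e³ + 16e∕β*) ≤ (1 − θ)∕2` (all met below `threshold_exists`'s e₀).  THEN g_j = g′_j at every j ≤ K.  Gen 33's `runs_eq_of_fadingMemory` with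
the weight sum read off the CONTAGION profiles of §3: no AF letter `BetaLowerH b`, no sign letter, no smallness of γ against the modulus or the
rate, no g-uniform Theorem 2 — the box may even contain Markov folds (Cγ³ large); runs ending near zero never reach them. [cite: Balaban1987RG1, Thm 2 p.259 («g₀ = g₀(ε, g)») with (0.20) p.256 and p.298] -/
theorem runs_eq_of_reference_fadingMemory {γ θ C bs : ℝ} {Λ : ℕ → ℕ → ℝ} {K : ℕ} {g g' t : ℕ → ℝ}
    (hθ0 : 0 < θ) (hθ1 : θ < 1) (hC : 0 ≤ C) (hbs : 0 < bs)
    (hL : HistLipschitz Λ γ S.β) (hΛ : FadingMemory C θ Λ)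
    (hg : RGEqH K S.β g) (hg' : RGEqH K S.β g') (ht : RGEqH K S.β t)
    (hbox : ∀ i, i ≤ K → 0 < g i ∧ g i ≤ γ) (hbox' : ∀ i, i ≤ K → 0 < g' i ∧ g' i ≤ γ)
    (hboxt : ∀ i, i ≤ K → 0 < t i ∧ t i ≤ γ) (hpin : g K = g' K)
    (h031 : ∀ i, i ≤ K → 1 / (t K) ^ 2 + bs * ((K : ℝ) - i) ≤ 1 / (t i) ^ 2)
    (hs1 : 4 * C * g K ≤ bs * (1 - θ))
    (hs2 : (g K) ^ 2 * (C * γ / (1 - θ) ^ 2 + C / (1 - θ) * t K + (2 * C / ((1 - θ) * bs)) ^ 2 + 1 / (4 * (t K) ^ 2))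
      ≤ 3 / 4)
    (hs3 : C * (8 * (g K) ^ 3 + 16 * g K / bs) ≤ (1 - θ) / 2) :
    ∀ j, j ≤ K → g j = g' j := by
  have hA := inv_sq_lower_of_reference hθ0.le hθ1 hC hbs hL hΛ hg ht hbox hboxt h031 hs1 hs2
  rw [hpin] at hs1 hs2
  have hB := inv_sq_lower_of_reference hθ0.le hθ1 hC hbs hL hΛ hg' ht hbox' hboxt h031 hs1 hs2
  exact runs_eq_of_fadingMemory hθ0 hθ1 hC hg hg' hbox hbox' hpin hL hΛ
    (sum_weights_le_of_reference hbs (fun i hi => (hbox i hi).1) (fun i hi => (hbox' i hi).1) hpin hA hB) hs3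

end

end Summit.QuantumFields.BalabanUV.Beta.EriceFlowEnclosureB12AsPrintedHistoryContagionProfile
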